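import Summits.QuantumFields.BalabanUV.Beta.EriceRemainderEnclosureHistoryAutonomyComparisonDualRow

/-!
# EriceRemainderEnclosureHistoryAutonomyComparisonDualGauge — (E134) **THE GAUGE STEP OF THE DUAL ROW INDUCTION — cost ≤ 1 per unit share, no bathtub, no smallness,
# any amplitude, Markov weight free.**  Affine base `B u = β₀ + Σ_{k<K} L_k·u_k` (`β₀ > 0`, `L ≥ 0`, `L_0` FREE; floor, modulus, unique box solutions `S p`), `B′ ≥ B` with
# the excess `B′ − B` ISOTONE (no modulus, size or steepness condition), ONE perturbed orbit `h′`; dual steps `X′_m = B′(tail_{m+1}h′) − B(tail_1 S h′_m)`, gauge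
# `g_m = X′_m·h′_m²` (the lattice `X∕α` of the continuum theorem (D‴), `HOME/b2b-balaban-beta-d4-p2/g103/README.md` §2).  **`gauge_step`**: if `X′_m ≥ 0` and
# `g_{m+1} ≤ g_m` for all `m ≥ n+1` then `X′_n ≥ 0` and `g_{n+1} ≤ g_n`.  HOW (README of this generation, `HOME/b2b-balaban-beta-d4-p2/g104/README.md` §1): in the dual
# row inequality (E133) `dual_row_ge` the window of age `k` is read through the gauge (`gauge_window_le`: `w_k²δ_k ≤ k·g_{n+1}`, from (E132) `dual_gap_le_sum_steps`) and
# `k·Φ⁰_k ≤ 1∕x_k² − 1∕h′_{n+1}²` (`steps_mul_le_rise`): the deficit of age `k` is at most `g_{n+1}·(x_k − x_k³∕h′_{n+1}²)` — NO bathtub, NO time→level conversion; if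
# `X′_n < 0` the two-pin offset has the helpful sign and the row gives `X′_n ≥ X′_{n+1}·β₀h′_{n+1}² ≥ 0`, a contradiction; if `X′_n ≥ 0` the row condition splits age by
# age into (E133) `age_cost_le` — first entry `θ∕2` (`θ = (S h′_n)_{1+k}²∕h′_n² ≤ min(1, ρ²x)`), window `1 − x` (`x = x_k²∕h′_{n+1}²`), share `ρ = (S h′_n)_{1+k}∕x_k ≥ 1`.
# The sequel (E135) `…ComparisonDualComparison` supplies the deep start and the induction: comparison for EVERY isotone excess at ANY size.

Cell `pub-balaban`, β-function sub-cell, BINDER row D4 «RemainderConst leaves for Bałaban's split» (`HOME/BINDER-OWNERS.md`; owner lineage `b2b-balaban-beta-an4`;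
this file by co-owner #2 lineage `b2b-balaban-beta-d4-p2`, generation 104), β-FLOW TEAM duty (1), FREEZE (0) honoured (def-free; imports (E133) `…ComparisonDualRow`;
uses its `coupling_gap_le` ∕ `age_cost_le` ∕ `dual_two_pin_le` ∕ `dual_row_ge`, (E132) `dual_step_eq_drop` ∕ `dual_source_antitone` ∕ `dual_gap_le_sum_steps` ∕
`cmp_of_dual_steps_nonneg`, (E48a) `family_zero` ∕ `family_mem` ∕ `family_tail_eq` ∕ `strictAnti_of_memFlow` BY NAME; (E116b) `flow_incr_mul_le_rise` at `n = 0`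
re-derived as `steps_mul_le_rise` to keep the imports minimal; nothing else restated).

HONEST FRAMING (page 1, verbatim and binding).  *"Discharging BetaPertH makes Bałaban's UV stability UNCONDITIONAL — a real constructive-QFT result; it is
NOT the continuum limit and NOT the Clay problem."*  THIS FILE DISCHARGES NOTHING OF THE KIND.  Elementary real analysis about ABSTRACT functionals on a box
]0,γ]^ℕ — hypotheses of a census, not facts; the form, signs, ages and moments of Bałaban's (1.22) limit functional are NOT PRINTED ([I] p. 298; GAPS
G-t4-U2-1∕-2) and NOT asserted.  Row D4 class UNCHANGED (critical-path width 0; instance 0∕1; D4 DISCHARGE NO DATE).  HONEST DEPENDENCY: continuum YM on T⁴ ⇐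
BetaPertH ∧ nine spine estimates (0/9 proved); BetaPertH ⇐ (D1) ∧ (D4) ∧ CAP+tail.  NOT CLAIMED here: the comparison theorem (the sequel); anything printed — NOT B12
Thm 2, NOT BetaPertH, NOT continuum, NOT Clay.

WHAT IS PROVED ([folklore]; 0 `def`, 0 sorry).  §1 `steps_mul_le_rise`, `cmp_from_pin`, `step_le_excess`, `source_chain`, `gauge_chain`, `pert_step_le_level`.  §2 **`gauge_window_le`**,
**`gauge_step`**.
-/

noncomputable section
open Finset Set

namespace Summit.QuantumFields.BalabanUV.Beta.EriceRemainderEnclosureHistoryAutonomyComparisonDualGauge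

open Literature.MathematicalPhysics.QuantumFieldTheory.Balaban1983to89
open Literature.MathematicalPhysics.QuantumFieldTheory.Balaban1983to89.T4BetaStationary
open Literature.MathematicalPhysics.QuantumFieldTheory.Balaban1983to89.T4BetaFlowWellPosed
open Summit.QuantumFields.BalabanUV.Beta.EriceRemainderEnclosureHistoryAutonomyOrder
  (family_zero family_mem family_tail_eq family_succ_eq le_of_pin_le strictAnti_of_memFlow)
open Summit.QuantumFields.BalabanUV.Beta.EriceRemainderEnclosureHistoryAutonomyComparisonDualOrbit
  (dual_step_eq_drop dual_source_antitone dual_gap_le_sum_steps cmp_of_dual_steps_nonneg)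
open Summit.QuantumFields.BalabanUV.Beta.EriceRemainderEnclosureHistoryAutonomyComparisonDualRow
  (coupling_gap_le age_cost_le dual_two_pin_le dual_row_ge)

variable {B B' : (ℕ → ℝ) → ℝ} {M γ b β₀ : ℝ} {L : ℕ → ℝ} {K : ℕ} {S : ℝ → ℕ → ℝ} {h' : ℕ → ℝ}

/-! ## §1 Bookkeeping along the two flows -/

/-- Along a box solution of an isotone functional with a floor, `k` times the level step ABOVE row `k` is at most the rise from the pin to row `k`:
`k·(1∕h_{k+1}² − 1∕h_k²) ≤ 1∕h_k² − 1∕h_0²` (the increments do not grow going up; (E116b) `flow_incr_mul_le_rise` at `n = 0`, re-derived to keep the imports minimal). [folklore] -/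
theorem steps_mul_le_rise {h : ℕ → ℝ} {q : ℝ} (hmono : ∀ u v : ℕ → ℝ, SeqBox γ u → SeqBox γ v → (∀ i, u i ≤ v i) → B u ≤ B v)
    (hb : 0 < b) (hlo : ∀ u, SeqBox γ u → b ≤ B u) (hh : SeqBox γ h) (hf : MemFlow B q h) :
    ∀ k : ℕ, (k : ℝ) * (1 / h (k + 1) ^ 2 - 1 / h k ^ 2) ≤ 1 / h k ^ 2 - 1 / h 0 ^ 2
  | 0 => by simp
  | k + 1 => by
    have ih := steps_mul_le_rise hmono hb hlo hh hf k
    have hanti := (strictAnti_of_memFlow hb hlo hh hf).antitone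
    have e1 : 1 / h (k + 1) ^ 2 - 1 / h k ^ 2 = B (fun i => h (k + 1 + i)) := by rw [hf.2 k]; ring
    have e2 : 1 / h (k + 1 + 1) ^ 2 - 1 / h (k + 1) ^ 2 = B (fun i => h (k + 1 + 1 + i)) := by rw [hf.2 (k + 1)]; ring
    have hdec : B (fun i => h (k + 1 + 1 + i)) ≤ B (fun i => h (k + 1 + i)) :=
      hmono _ _ (seqBox_shift hh (k + 1 + 1)) (seqBox_shift hh (k + 1)) fun i => hanti (by omega)
    rw [e1] at ih
    rw [e2]
    push_cast
    nlinarith [hdec, ih]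

/-- COMPARISON FROM A PERTURBED PIN: if the dual steps are non-negative from row `j` on, the perturbed orbit lies below the base restarted at `h′_j`:
`h′_{j+l} ≤ (S h′_j)_l` for every `l` ((E132) `cmp_of_dual_steps_nonneg` on the tail orbit). [folklore] -/
theorem cmp_from_pin (hb : 0 < b)
    (hB : ∀ u u' : ℕ → ℝ, SeqBox γ u → SeqBox γ u' → ∀ D : ℝ, (∀ j, |u j - u' j| ≤ D) → |B u - B u'| ≤ M * D) (hM : 0 ≤ M)
    (hlo : ∀ u, SeqBox γ u → b ≤ B u)
    (hS : ∀ p, 0 < p → p ≤ γ → SeqBox γ (S p) ∧ MemFlow B p (S p))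
    (huniq : ∀ p, 0 < p → p ≤ γ → ∀ u u' : ℕ → ℝ, SeqBox γ u → SeqBox γ u' → MemFlow B p u → MemFlow B p u' → u = u')
    (hh' : SeqBox γ h') {y : ℝ} (hf' : MemFlow B' y h') (j : ℕ)
    (hX : ∀ l, 0 ≤ B' (fun i => h' (j + l + 1 + i)) - B (fun i => S (h' (j + l)) (1 + i))) : ∀ l, h' (j + l) ≤ S (h' j) l := by
  intro l
  have htailbox : SeqBox γ (fun i => h' (j + i)) := fun i => hh' (j + i)
  have htailflow : MemFlow B' (h' j) (fun i => h' (j + i)) := by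
    refine ⟨by simp, fun m => ?_⟩
    have := hf'.2 (j + m)
    simpa [Nat.add_assoc] using this
  have := cmp_of_dual_steps_nonneg (B' := B') hb hB hM hlo hS huniq (hh' j).1 (hh' j).2 htailbox htailflow l
    (fun i _ => by
      have h1 := hX i
      have e : (fun q => h' (j + (i + 1 + q))) = (fun q => h' (j + i + 1 + q)) := by funext q; simp [Nat.add_assoc]
      rw [e]; linarith) l le_rfl
  simpa using this

/-- THE DUAL STEP NEVER EXCEEDS THE EXCESS: under comparison from the pin `h′_m`, `X′_m ≤ E_m = (B′ − B)(tail_{m+1}h′)` — the affine drop is non-negative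
(`dual_step_eq_drop`). [folklore] -/
theorem step_le_excess (hBaff : ∀ u, SeqBox γ u → B u = β₀ + ∑ k ∈ range K, L k * u k) (hL : ∀ k, 0 ≤ L k)
    (hS : ∀ p, 0 < p → p ≤ γ → SeqBox γ (S p) ∧ MemFlow B p (S p)) (hh' : SeqBox γ h') (m : ℕ)
    (hcmp : ∀ l, h' (m + l) ≤ S (h' m) l) :
    B' (fun i => h' (m + 1 + i)) - B (fun i => S (h' m) (1 + i))
      ≤ B' (fun i => h' (m + 1 + i)) - B (fun i => h' (m + 1 + i)) := by
  rw [dual_step_eq_drop (B' := B') hBaff hS hh' m]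
  have : 0 ≤ ∑ k ∈ range K, L k * (S (h' m) (1 + k) - h' (m + 1 + k)) :=
    sum_nonneg fun k _ => mul_nonneg (hL k) (by have := hcmp (1 + k); rw [show m + (1 + k) = m + 1 + k by ring] at this; linarith)
  linarith

/-- THE SOURCE CHAIN: along the non-increasing orbit the excess only grows going down, `E_{j+l} ≤ E_j` (`dual_source_antitone` iterated). [folklore] -/
theorem source_chain (hDmono : ∀ u v : ℕ → ℝ, SeqBox γ u → SeqBox γ v → (∀ i, u i ≤ v i) → B' u - B u ≤ B' v - B v)
    (hh' : SeqBox γ h') (hanti : Antitone h') (j : ℕ) :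
    ∀ l, B' (fun i => h' (j + l + 1 + i)) - B (fun i => h' (j + l + 1 + i)) ≤ B' (fun i => h' (j + 1 + i)) - B (fun i => h' (j + 1 + i))
  | 0 => by simp
  | l + 1 => by
    have ih := source_chain hDmono hh' hanti j l
    have h1 := dual_source_antitone (B := B) (B' := B') hDmono hh' hanti (j + l)
    rw [show j + l + 2 = j + (l + 1) + 1 by ring] at h1
    exact h1.trans ih

/-- THE GAUGE CHAIN: `g_{m+1} ≤ g_m` for `m ≥ j` gives `g_{j+l} ≤ g_j`. [folklore] -/
theorem gauge_chain {g : ℕ → ℝ} {j : ℕ} (hg : ∀ m, j ≤ m → g (m + 1) ≤ g m) : ∀ l, g (j + l) ≤ g j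
  | 0 => by simp
  | l + 1 => by rw [show j + (l + 1) = j + l + 1 by ring]; exact (hg (j + l) (by omega)).trans (gauge_chain hg l)

/-- A LATE PERTURBED STEP IS BELOW THE LEVEL: for a box solution `h′` of an isotone functional with a floor and `m ≥ 1`,
`1∕h′_{m+1}² − 1∕h′_m² ≤ 1∕h′_1² − 1∕h′_0² ≤ 1∕h′_m²`. [folklore] -/
theorem pert_step_le_level {b' : ℝ} (hmono' : ∀ u v : ℕ → ℝ, SeqBox γ u → SeqBox γ v → (∀ i, u i ≤ v i) → B' u ≤ B' v)
    (hb' : 0 < b') (hlo' : ∀ u, SeqBox γ u → b' ≤ B' u) (hh' : SeqBox γ h') {y : ℝ} (hf' : MemFlow B' y h')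
    {m : ℕ} (hm : 1 ≤ m) : 1 / h' (m + 1) ^ 2 - 1 / h' m ^ 2 ≤ 1 / h' m ^ 2 := by
  have hanti := (strictAnti_of_memFlow hb' hlo' hh' hf').antitone
  have hpos : ∀ j, 0 < h' j := fun j => (hh' j).1
  have e1 : 1 / h' (m + 1) ^ 2 - 1 / h' m ^ 2 = B' (fun i => h' (m + 1 + i)) := by rw [hf'.2 m]; ring
  have e0 : 1 / h' (0 + 1) ^ 2 = 1 / h' 0 ^ 2 + B' (fun i => h' (0 + 1 + i)) := hf'.2 0
  have hdec : B' (fun i => h' (m + 1 + i)) ≤ B' (fun i => h' (0 + 1 + i)) :=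
    hmono' _ _ (seqBox_shift hh' (m + 1)) (seqBox_shift hh' (0 + 1)) fun i => hanti (by omega)
  have hlev : 1 / h' (0 + 1) ^ 2 ≤ 1 / h' m ^ 2 :=
    one_div_le_one_div_of_le (pow_pos (hpos m) 2) (pow_le_pow_left₀ (hpos m).le (hanti (by omega)) 2)
  have h00 : 0 < 1 / h' 0 ^ 2 := by have := hpos 0; positivity
  rw [e1]; linarith

/-! ## §2 The gauge step: the window through the level gauge, and the row -/

/-- **THE DUAL WINDOW THROUGH THE GAUGE.**  With the dual steps non-negative from row `n+1` on and the gauge `g_m = X′_m·h′_m²` non-increasing there, the window gap of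
configuration `n+1` at age `k` satisfies `w_k²·δ_k ≤ k·g_{n+1}` (`w_k = h′_{n+1+k}`): `δ_k ≤ Σ_{l<k} X′_{n+1+l}` ((E132) `dual_gap_le_sum_steps`), each
`X′_{n+1+l} = g_{n+1+l}∕h′_{n+1+l}² ≤ g_{n+1}∕w_k²`. [folklore] -/
theorem gauge_window_le (hb : 0 < b)
    (hmono : ∀ u v : ℕ → ℝ, SeqBox γ u → SeqBox γ v → (∀ i, u i ≤ v i) → B u ≤ B v)
    (hB : ∀ u u' : ℕ → ℝ, SeqBox γ u → SeqBox γ u' → ∀ D : ℝ, (∀ j, |u j - u' j| ≤ D) → |B u - B u'| ≤ M * D) (hM : 0 ≤ M)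
    (hlo : ∀ u, SeqBox γ u → b ≤ B u)
    (hS : ∀ p, 0 < p → p ≤ γ → SeqBox γ (S p) ∧ MemFlow B p (S p))
    (huniq : ∀ p, 0 < p → p ≤ γ → ∀ u u' : ℕ → ℝ, SeqBox γ u → SeqBox γ u' → MemFlow B p u → MemFlow B p u' → u = u')
    (hh' : SeqBox γ h') (hanti : Antitone h') {y : ℝ} (hf' : MemFlow B' y h') (n k : ℕ)
    (hXup : ∀ l, 0 ≤ B' (fun i => h' (n + 1 + l + 1 + i)) - B (fun i => S (h' (n + 1 + l)) (1 + i)))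
    (hg : ∀ m, n + 1 ≤ m → (B' (fun i => h' (m + 1 + 1 + i)) - B (fun i => S (h' (m + 1)) (1 + i))) * h' (m + 1) ^ 2
      ≤ (B' (fun i => h' (m + 1 + i)) - B (fun i => S (h' m) (1 + i))) * h' m ^ 2) :
    h' (n + 1 + k) ^ 2 * (1 / h' (n + 1 + k) ^ 2 - 1 / S (h' (n + 1)) k ^ 2)
      ≤ (k : ℝ) * ((B' (fun i => h' (n + 1 + 1 + i)) - B (fun i => S (h' (n + 1)) (1 + i))) * h' (n + 1) ^ 2) := by
  set g : ℕ → ℝ := fun m => (B' (fun i => h' (m + 1 + i)) - B (fun i => S (h' m) (1 + i))) * h' m ^ 2 with hgdef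
  have hgc : ∀ l, g (n + 1 + l) ≤ g (n + 1) := gauge_chain (g := g) (j := n + 1) (fun m hm => hg m hm)
  have hpos : ∀ j, 0 < h' j := fun j => (hh' j).1
  obtain ⟨_, hsum⟩ := dual_gap_le_sum_steps (B' := B') hb hmono hB hM hlo hS huniq hh' hf' (n + 1) k (fun l _ => hXup l)
  -- each summand ≤ g(n+1) / w_k²
  have hterm : ∀ l ∈ range k, B' (fun i => h' (n + 1 + l + 1 + i)) - B (fun i => S (h' (n + 1 + l)) (1 + i)) ≤ g (n + 1) * (1 / h' (n + 1 + k) ^ 2) := by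
    intro l hl
    have hlk : l < k := mem_range.mp hl
    have hwl : 0 < h' (n + 1 + l) := hpos _
    have e : B' (fun i => h' (n + 1 + l + 1 + i)) - B (fun i => S (h' (n + 1 + l)) (1 + i)) = g (n + 1 + l) * (1 / h' (n + 1 + l) ^ 2) := by
      simp only [hgdef]; field_simp
    rw [e]
    have hg0 : 0 ≤ g (n + 1) := by
      have := hXup 0
      simp only [hgdef, Nat.add_zero] at this ⊢
      exact mul_nonneg this (sq_nonneg _)
    have hlev : 1 / h' (n + 1 + l) ^ 2 ≤ 1 / h' (n + 1 + k) ^ 2 :=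
      one_div_le_one_div_of_le (pow_pos (hpos _) 2) (pow_le_pow_left₀ (hpos _).le (hanti (by omega)) 2)
    have hgl0 : g (n + 1 + l) * (1 / h' (n + 1 + l) ^ 2) ≤ g (n + 1) * (1 / h' (n + 1 + l) ^ 2) :=
      mul_le_mul_of_nonneg_right (hgc l) (by positivity)
    exact hgl0.trans (mul_le_mul_of_nonneg_left hlev hg0)
  have hs := (hsum.trans (sum_le_sum hterm))
  rw [sum_const, card_range, nsmul_eq_mul] at hs
  have := mul_le_mul_of_nonneg_left hs (pow_pos (hpos (n + 1 + k)) 2).le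
  have hne : h' (n + 1 + k) ≠ 0 := (hpos _).ne'
  have e2 : h' (n + 1 + k) ^ 2 * ((k : ℝ) * (g (n + 1) * (1 / h' (n + 1 + k) ^ 2))) = (k : ℝ) * g (n + 1) := by
    field_simp
  rw [e2] at this
  exact this

set_option maxHeartbeats 800000 in
/-- **THE GAUGE STEP OF THE DUAL ROW INDUCTION.**  Affine base `B u = β₀ + Σ_{k<K} L_k u_k` (`β₀ > 0`, `L ≥ 0`, Markov weight `L_0` FREE; floor, modulus, unique box
solutions `S p`), `B′ ≥ B` with ISOTONE excess (no modulus, size or steepness condition), `h′` a box solution of `B′`, dual steps `X′_m = B′(tail_{m+1}h′) − B(tail_1 S h′_m)`,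
gauge `g_m = X′_m·h′_m²`.  If `X′_m ≥ 0` and `g_{m+1} ≤ g_m` for every `m ≥ n+1`, then `X′_n ≥ 0` and `g_{n+1} ≤ g_n`.  PROOF: `dual_row_ge`; the window through the
gauge (`gauge_window_le`: `w_k²δ_k ≤ k·g_{n+1}`) and `k·Φ⁰_k ≤ 1∕x_k² − 1∕h′_{n+1}²` (`steps_mul_le_rise`) turn the deficit of age `k` into `g_{n+1}·(x_k − x_k³∕h′_{n+1}²)`;
if `X′_n < 0` the two-pin offset helps and `X′_n ≥ X′_{n+1}·β₀h′_{n+1}² ≥ 0` — contradiction; if `X′_n ≥ 0` the row closes age by age by `age_cost_le`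
(`θ∕2 + (1 − x) ≤ ρ`: first entry `θ = (S h′_n)_{1+k}²∕h′_n²`, window share `1 − x = 1 − x_k²∕h′_{n+1}²`, budget ratio `ρ = (S h′_n)_{1+k}∕x_k ≥ 1`).  COST ≤ 1 PER UNIT SHARE —
no bathtub, no smallness, any amplitude. [folklore] -/
theorem gauge_step (hBaff : ∀ u, SeqBox γ u → B u = β₀ + ∑ k ∈ range K, L k * u k) (hβ : 0 < β₀) (hL : ∀ k, 0 ≤ L k)
    (hb : 0 < b)
    (hmono : ∀ u v : ℕ → ℝ, SeqBox γ u → SeqBox γ v → (∀ i, u i ≤ v i) → B u ≤ B v)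
    (hB : ∀ u u' : ℕ → ℝ, SeqBox γ u → SeqBox γ u' → ∀ D : ℝ, (∀ j, |u j - u' j| ≤ D) → |B u - B u'| ≤ M * D) (hM : 0 ≤ M)
    (hlo : ∀ u, SeqBox γ u → b ≤ B u)
    (hS : ∀ p, 0 < p → p ≤ γ → SeqBox γ (S p) ∧ MemFlow B p (S p))
    (huniq : ∀ p, 0 < p → p ≤ γ → ∀ u u' : ℕ → ℝ, SeqBox γ u → SeqBox γ u' → MemFlow B p u → MemFlow B p u' → u = u')
    (hexc : ∀ u, SeqBox γ u → B u ≤ B' u)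
    (hDmono : ∀ u v : ℕ → ℝ, SeqBox γ u → SeqBox γ v → (∀ i, u i ≤ v i) → B' u - B u ≤ B' v - B v)
    (hh' : SeqBox γ h') {y : ℝ} (hf' : MemFlow B' y h') (n : ℕ)
    (hXup : ∀ l, 0 ≤ B' (fun i => h' (n + 1 + l + 1 + i)) - B (fun i => S (h' (n + 1 + l)) (1 + i)))
    (hg : ∀ m, n + 1 ≤ m → (B' (fun i => h' (m + 1 + 1 + i)) - B (fun i => S (h' (m + 1)) (1 + i))) * h' (m + 1) ^ 2
      ≤ (B' (fun i => h' (m + 1 + i)) - B (fun i => S (h' m) (1 + i))) * h' m ^ 2) :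
    0 ≤ B' (fun i => h' (n + 1 + i)) - B (fun i => S (h' n) (1 + i))
      ∧ (B' (fun i => h' (n + 1 + 1 + i)) - B (fun i => S (h' (n + 1)) (1 + i))) * h' (n + 1) ^ 2
        ≤ (B' (fun i => h' (n + 1 + i)) - B (fun i => S (h' n) (1 + i))) * h' n ^ 2 := by
  -- derived facts
  have hmono' : ∀ u v : ℕ → ℝ, SeqBox γ u → SeqBox γ v → (∀ i, u i ≤ v i) → B' u ≤ B' v := fun u v hu hv hle => by
    linarith [hmono u v hu hv hle, hDmono u v hu hv hle]
  have hlo' : ∀ u, SeqBox γ u → b ≤ B' u := fun u hu => (hlo u hu).trans (hexc u hu)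
  have hanti : Antitone h' := (strictAnti_of_memFlow hb hlo' hh' hf').antitone
  have hpos : ∀ j, 0 < h' j := fun j => (hh' j).1
  have hcmp : ∀ l, h' (n + 1 + l) ≤ S (h' (n + 1)) l := cmp_from_pin (B' := B') hb hB hM hlo hS huniq hh' hf' (n + 1) hXup
  have hp1 := hh' (n + 1)
  have hpn := hh' n
  have hS1 := hS (h' (n + 1)) hp1.1 hp1.2
  have hSn := hS (h' n) hpn.1 hpn.2
  have hxpos : ∀ k, 0 < S (h' (n + 1)) k := fun k => (hS1.1 k).1
  have hx0 : S (h' (n + 1)) 0 = h' (n + 1) := family_zero hS hp1.1 hp1.2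
  have hxanti := (strictAnti_of_memFlow hb hlo hS1.1 hS1.2).antitone
  have hσanti := (strictAnti_of_memFlow hb hlo hSn.1 hSn.2).antitone
  set X0 : ℝ := B' (fun i => h' (n + 1 + i)) - B (fun i => S (h' n) (1 + i)) with hX0
  set X1 : ℝ := B' (fun i => h' (n + 1 + 1 + i)) - B (fun i => S (h' (n + 1)) (1 + i)) with hX1
  set u0 : ℝ := h' n ^ 2 with hu0
  set u1 : ℝ := h' (n + 1) ^ 2 with hu1
  have hu0p : 0 < u0 := pow_pos (hpos n) 2
  have hu1p : 0 < u1 := pow_pos (hpos (n + 1)) 2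
  have hu10 : u1 ≤ u0 := pow_le_pow_left₀ (hpos _).le (hanti (Nat.le_succ n)) 2
  have hX1nn : 0 ≤ X1 := by have := hXup 0; simp only [Nat.add_zero] at this; exact this
  -- the level forms of X0, X1 and of the steps
  have hlev0 : X0 = 1 / h' (n + 1) ^ 2 - 1 / h' n ^ 2 - B (fun i => S (h' n) (1 + i)) := by rw [hX0, hf'.2 n]; ring
  have hlev1 : B' (fun i => h' (n + 1 + 1 + i)) = 1 / h' (n + 1 + 1) ^ 2 - 1 / h' (n + 1) ^ 2 := by rw [hf'.2 (n + 1)]; ring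
  -- the base step at the perturbed pin h′_{n+1} is below the level there
  have hΦ00 : B (fun i => S (h' (n + 1)) (1 + i)) ≤ 1 / u1 := by
    have h1 : B (fun i => S (h' (n + 1)) (1 + i)) ≤ B' (fun i => h' (n + 1 + 1 + i)) := by linarith [hX1nn]
    have h2 := pert_step_le_level hmono' hb hlo' hh' hf' (m := n + 1) (by omega)
    rw [hlev1] at h1; simp only [hu1]; linarith
  -- the row inequality
  have hrow := dual_row_ge (B' := B') hBaff hβ.le hL hb hmono hB hM hlo hS huniq hDmono hh' hanti hf' n hcmp hXup
  -- the deficit sum through the gauge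
  set C : ℝ := ∑ k ∈ range K, L k * (S (h' (n + 1)) k - S (h' (n + 1)) k ^ 3 / u1) with hC
  have hdef : ∑ k ∈ range K, L k * (S (h' (n + 1)) k ^ 3 * (1 / S (h' (n + 1)) (k + 1) ^ 2 - 1 / S (h' (n + 1)) k ^ 2)
        * (h' (n + 1 + k) ^ 2 * (1 / h' (n + 1 + k) ^ 2 - 1 / S (h' (n + 1)) k ^ 2))) ≤ X1 * u1 * C := by
    rw [hC, mul_sum]
    refine sum_le_sum fun k _ => ?_
    have hw := gauge_window_le (B' := B') hb hmono hB hM hlo hS huniq hh' hanti hf' n k hXup hg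
    have hrise := steps_mul_le_rise hmono hb hlo hS1.1 hS1.2 k
    rw [hx0] at hrise
    have hxk := hxpos k
    have hΦk : 0 ≤ 1 / S (h' (n + 1)) (k + 1) ^ 2 - 1 / S (h' (n + 1)) k ^ 2 := by
      rw [hS1.2.2 k]; linarith [hlo _ (seqBox_shift hS1.1 (k + 1))]
    have hg1 : 0 ≤ X1 * u1 := mul_nonneg hX1nn hu1p.le
    -- x³Φ⁰(w²δ) ≤ x³Φ⁰·k·g₁ = g₁·x³·(kΦ⁰) ≤ g₁·x³·(1/x² − 1/u1) = g₁·(x − x³/u1)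
    have step1 : S (h' (n + 1)) k ^ 3 * (1 / S (h' (n + 1)) (k + 1) ^ 2 - 1 / S (h' (n + 1)) k ^ 2)
        * (h' (n + 1 + k) ^ 2 * (1 / h' (n + 1 + k) ^ 2 - 1 / S (h' (n + 1)) k ^ 2))
        ≤ S (h' (n + 1)) k ^ 3 * (1 / S (h' (n + 1)) (k + 1) ^ 2 - 1 / S (h' (n + 1)) k ^ 2) * ((k : ℝ) * (X1 * u1)) :=
      mul_le_mul_of_nonneg_left hw (by positivity)
    have step2 : S (h' (n + 1)) k ^ 3 * ((k : ℝ) * (1 / S (h' (n + 1)) (k + 1) ^ 2 - 1 / S (h' (n + 1)) k ^ 2))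
        ≤ S (h' (n + 1)) k ^ 3 * (1 / S (h' (n + 1)) k ^ 2 - 1 / h' (n + 1) ^ 2) :=
      mul_le_mul_of_nonneg_left hrise (by positivity)
    have e3 : S (h' (n + 1)) k ^ 3 * (1 / S (h' (n + 1)) k ^ 2 - 1 / h' (n + 1) ^ 2) = S (h' (n + 1)) k - S (h' (n + 1)) k ^ 3 / u1 := by
      simp only [hu1]; field_simp
    have step3 := mul_le_mul_of_nonneg_left step2 hg1
    rw [e3] at step3
    have hk : S (h' (n + 1)) k ^ 3 * (1 / S (h' (n + 1)) (k + 1) ^ 2 - 1 / S (h' (n + 1)) k ^ 2)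
        * (h' (n + 1 + k) ^ 2 * (1 / h' (n + 1 + k) ^ 2 - 1 / S (h' (n + 1)) k ^ 2))
        ≤ X1 * u1 * (S (h' (n + 1)) k - S (h' (n + 1)) k ^ 3 / u1) :=
      calc _ ≤ S (h' (n + 1)) k ^ 3 * (1 / S (h' (n + 1)) (k + 1) ^ 2 - 1 / S (h' (n + 1)) k ^ 2) * ((k : ℝ) * (X1 * u1)) := step1
        _ = X1 * u1 * (S (h' (n + 1)) k ^ 3 * ((k : ℝ) * (1 / S (h' (n + 1)) (k + 1) ^ 2 - 1 / S (h' (n + 1)) k ^ 2))) := by ring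
        _ ≤ X1 * u1 * (S (h' (n + 1)) k - S (h' (n + 1)) k ^ 3 / u1) := step3
    have := mul_le_mul_of_nonneg_left hk (hL k)
    linarith [this]
  -- the coefficient C is paid by the budget at the pin h′_{n+1}:  u1·C ≤ 1 − u1·β₀ < 1
  have hCle : C ≤ ∑ k ∈ range K, L k * S (h' (n + 1)) (1 + k) := by
    rw [hC]
    refine sum_le_sum fun k _ => mul_le_mul_of_nonneg_left ?_ (hL k)
    -- x_k − x_k³/u1 ≤ x_{k+1}
    have hxk := hxpos k
    have hxk1 := hxpos (k + 1)
    have hle : S (h' (n + 1)) (k + 1) ≤ S (h' (n + 1)) k := hxanti (Nat.le_succ k)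
    have hgap := coupling_gap_le hxk1 hle
    -- the step Φ⁰_k ≤ Φ⁰_0 ≤ 1/u1
    have hΦk : 1 / S (h' (n + 1)) (k + 1) ^ 2 - 1 / S (h' (n + 1)) k ^ 2 ≤ 1 / u1 := by
      have e1 : 1 / S (h' (n + 1)) (k + 1) ^ 2 - 1 / S (h' (n + 1)) k ^ 2 = B (fun i => S (h' (n + 1)) (k + 1 + i)) := by
        rw [hS1.2.2 k]; ring
      have hdec : B (fun i => S (h' (n + 1)) (k + 1 + i)) ≤ B (fun i => S (h' (n + 1)) (0 + 1 + i)) :=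
        hmono _ _ (seqBox_shift hS1.1 (k + 1)) (seqBox_shift hS1.1 (0 + 1)) fun i => hxanti (by omega)
      have e0 : (fun i => S (h' (n + 1)) (0 + 1 + i)) = (fun i => S (h' (n + 1)) (1 + i)) := by funext i; simp
      rw [e0] at hdec
      rw [e1]; exact hdec.trans hΦ00
    have hΦk0 : 0 ≤ 1 / S (h' (n + 1)) (k + 1) ^ 2 - 1 / S (h' (n + 1)) k ^ 2 := by
      rw [hS1.2.2 k]; linarith [hlo _ (seqBox_shift hS1.1 (k + 1))]
    -- x_k − x_{k+1} ≤ Φ⁰_k·x_k²x_{k+1}/2 ≤ (1/u1)·x_k²·x_k/2 ≤ x_k³/u1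
    have h1 : (1 / S (h' (n + 1)) (k + 1) ^ 2 - 1 / S (h' (n + 1)) k ^ 2) * (S (h' (n + 1)) k ^ 2 * S (h' (n + 1)) (k + 1) / 2)
        ≤ 1 / u1 * (S (h' (n + 1)) k ^ 2 * S (h' (n + 1)) k / 2) :=
      mul_le_mul hΦk (by nlinarith [mul_le_mul_of_nonneg_left hle (sq_nonneg (S (h' (n + 1)) k))]) (by positivity) (by positivity)
    have h2 : 1 / u1 * (S (h' (n + 1)) k ^ 2 * S (h' (n + 1)) k / 2) ≤ S (h' (n + 1)) k ^ 3 / u1 := by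
      rw [le_div_iff₀ hu1p]
      have e : 1 / u1 * (S (h' (n + 1)) k ^ 2 * S (h' (n + 1)) k / 2) * u1 = S (h' (n + 1)) k ^ 3 / 2 := by field_simp
      rw [e]; nlinarith [pow_pos hxk 3]
    rw [show 1 + k = k + 1 by ring]
    linarith [hgap, h1, h2]
  have hbudget1 : u1 * (∑ k ∈ range K, L k * S (h' (n + 1)) (1 + k)) ≤ 1 - u1 * β₀ := by
    have e : ∑ k ∈ range K, L k * S (h' (n + 1)) (1 + k) = B (fun i => S (h' (n + 1)) (1 + i)) - β₀ := by
      rw [hBaff _ (fun i => hS1.1 (1 + i))]; ring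
    rw [e]
    have := mul_le_mul_of_nonneg_left hΦ00 hu1p.le
    rw [mul_one_div_cancel hu1p.ne'] at this
    nlinarith [this]
  have hC1 : u1 * C < 1 := by
    have := mul_le_mul_of_nonneg_left hCle hu1p.le
    nlinarith [mul_pos hu1p hβ]
  -- the two cases of the sign of X′_n
  have hF0 : 0 ≤ ∑ k ∈ range K, L k * (S (h' n) (1 + k) ^ 2 * S (h' (n + 1)) k / 2) :=
    sum_nonneg fun k _ => by have := hL k; have := (hSn.1 (1 + k)).1; have := hxpos k; positivity
  by_cases h0 : 0 ≤ X0
  · refine ⟨h0, ?_⟩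
    rw [max_eq_left h0] at hrow
    -- the row condition F + u0·C ≤ u0·Σ L_k (S h′_n)_{1+k}, age by age
    have hle1 : h' (n + 1) ≤ S (h' n) 1 := by
      have hσ1 := (hSn.1 1).1
      refine (pow_le_pow_iff_left₀ (hpos (n + 1)).le hσ1.le two_ne_zero).mp
        ((one_div_le_one_div (pow_pos hσ1 2) (pow_pos (hpos (n + 1)) 2)).mp ?_)
      have : 0 ≤ 1 / h' (n + 1) ^ 2 - 1 / h' n ^ 2 - B (fun i => S (h' n) (1 + i)) := by rw [← hlev0]; exact h0
      have e2 : 1 / S (h' n) (0 + 1) ^ 2 = 1 / S (h' n) 0 ^ 2 + B (fun i => S (h' n) (0 + 1 + i)) := hSn.2.2 0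
      rw [family_zero hS hpn.1 hpn.2] at e2
      have e3 : (fun i => S (h' n) (0 + 1 + i)) = (fun i => S (h' n) (1 + i)) := by funext i; simp
      rw [e3] at e2; simp only [Nat.zero_add] at e2
      linarith
    have hcond : ∑ k ∈ range K, L k * (S (h' n) (1 + k) ^ 2 * S (h' (n + 1)) k / 2) + u0 * C
        ≤ u0 * ∑ k ∈ range K, L k * S (h' n) (1 + k) := by
      rw [hC, mul_sum, mul_sum, ← sum_add_distrib]
      refine sum_le_sum fun k _ => ?_
      have hxk := hxpos k
      have hσ := (hSn.1 (1 + k)).1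
      obtain ⟨hρ0, _⟩ := dual_two_pin_le hb hmono hB hM hlo hS huniq hh' n hle1 k
      -- the reduced variables of age_cost_le
      have hρ : 1 ≤ S (h' n) (1 + k) / S (h' (n + 1)) k := by rw [le_div_iff₀ hxk]; linarith
      have hxw0 : 0 < S (h' (n + 1)) k ^ 2 / u1 := by positivity
      have hxw1 : S (h' (n + 1)) k ^ 2 / u1 ≤ 1 := by
        rw [div_le_one hu1p, hu1]
        have hk0 : S (h' (n + 1)) k ≤ S (h' (n + 1)) 0 := hxanti (Nat.zero_le k)
        rw [hx0] at hk0
        exact pow_le_pow_left₀ hxk.le hk0 2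
      have hθ0 : 0 ≤ S (h' n) (1 + k) ^ 2 / u0 := by positivity
      have hθ1 : S (h' n) (1 + k) ^ 2 / u0 ≤ 1 := by
        rw [div_le_one hu0p, hu0]
        have : S (h' n) (1 + k) ≤ S (h' n) 0 := hσanti (Nat.zero_le _)
        rw [family_zero hS hpn.1 hpn.2] at this
        exact pow_le_pow_left₀ hσ.le this 2
      have hθρ : S (h' n) (1 + k) ^ 2 / u0 ≤ (S (h' n) (1 + k) / S (h' (n + 1)) k) ^ 2 * (S (h' (n + 1)) k ^ 2 / u1) := by
        have e : (S (h' n) (1 + k) / S (h' (n + 1)) k) ^ 2 * (S (h' (n + 1)) k ^ 2 / u1) = S (h' n) (1 + k) ^ 2 / u1 := by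
          field_simp
        rw [e]
        exact div_le_div_of_nonneg_left (sq_nonneg _) hu1p hu10
      have hage := age_cost_le hρ hxw0 hxw1 hθ0 hθ1 hθρ
      -- multiply back by u0·x_k > 0
      have hux : 0 < u0 * S (h' (n + 1)) k := mul_pos hu0p hxk
      have := mul_le_mul_of_nonneg_left hage hux.le
      have e1 : u0 * S (h' (n + 1)) k * (S (h' n) (1 + k) ^ 2 / u0 / 2 + (1 - S (h' (n + 1)) k ^ 2 / u1))
          = S (h' n) (1 + k) ^ 2 * S (h' (n + 1)) k / 2 + u0 * (S (h' (n + 1)) k - S (h' (n + 1)) k ^ 3 / u1) := by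
        field_simp
      have e2 : u0 * S (h' (n + 1)) k * (S (h' n) (1 + k) / S (h' (n + 1)) k) = u0 * S (h' n) (1 + k) := by
        field_simp
      rw [e1, e2] at this
      have hLk := hL k
      nlinarith [mul_le_mul_of_nonneg_left this hLk]
    -- the budget at the pin h′_n:  Σ L_k (S h′_n)_{1+k} = B(tail_1 S h′_n) − β₀ ≤ Φ′_n − β₀
    have hbud : u0 * ∑ k ∈ range K, L k * S (h' n) (1 + k) ≤ u0 / u1 - 1 - u0 * β₀ := by
      have e : ∑ k ∈ range K, L k * S (h' n) (1 + k) = B (fun i => S (h' n) (1 + i)) - β₀ := by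
        rw [hBaff _ (fun i => hSn.1 (1 + i))]; ring
      have hB0 : B (fun i => S (h' n) (1 + i)) ≤ 1 / h' (n + 1) ^ 2 - 1 / h' n ^ 2 := by rw [hlev0] at h0; linarith
      rw [e]
      have h1 := mul_le_mul_of_nonneg_left hB0 hu0p.le
      have e2 : u0 * (1 / h' (n + 1) ^ 2 - 1 / h' n ^ 2) = u0 / u1 - 1 := by
        simp only [hu0, hu1]; rw [mul_sub, mul_one_div, mul_one_div_cancel (pow_pos (hpos n) 2).ne']
      rw [e2] at h1
      nlinarith [h1]
    -- assemble: X1(1 − u1C) ≤ X0·(1 + F) ≤ X0·u0·(1∕u1 − C)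
    have A1 : X1 - X1 * u1 * C ≤ X0 * (1 + ∑ k ∈ range K, L k * (S (h' n) (1 + k) ^ 2 * S (h' (n + 1)) k / 2)) := by
      nlinarith [hrow, hdef]
    have A2 : 1 + ∑ k ∈ range K, L k * (S (h' n) (1 + k) ^ 2 * S (h' (n + 1)) k / 2) ≤ u0 / u1 - u0 * C := by
      nlinarith [hcond, hbud, mul_pos hu0p hβ]
    have A3 : X1 - X1 * u1 * C ≤ X0 * (u0 / u1 - u0 * C) := A1.trans (mul_le_mul_of_nonneg_left A2 h0)
    have A4 : X1 * u1 * (1 - u1 * C) ≤ X0 * u0 * (1 - u1 * C) := by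
      have := mul_le_mul_of_nonneg_left A3 hu1p.le
      have e1 : u1 * (X1 - X1 * u1 * C) = X1 * u1 * (1 - u1 * C) := by ring
      have e2 : u1 * (X0 * (u0 / u1 - u0 * C)) = X0 * u0 * (1 - u1 * C) := by field_simp
      rw [e1, e2] at this; exact this
    exact le_of_mul_le_mul_right A4 (by linarith)
  · exfalso
    have h0' : X0 < 0 := lt_of_not_ge h0
    rw [max_eq_right h0'.le, zero_mul, sub_zero] at hrow
    have A1 : X1 * (1 - u1 * C) ≤ X0 := by nlinarith [hrow, hdef]
    have A2 : 0 ≤ X1 * (1 - u1 * C) := mul_nonneg hX1nn (by linarith)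
    linarith

end Summit.QuantumFields.BalabanUV.Beta.EriceRemainderEnclosureHistoryAutonomyComparisonDualGauge

end
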